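import Literature.NumberTheory.EllipticCurves.KatoRankBoundSelmerProofs
import Literature.NumberTheory.EllipticCurves.IwasawaLeadingTermProofs
import HarnessLib

/-!
# Kato 2004, Thm 18.4 ⇒ `Ш(E/ℚ)[p^∞]` is finite as soon as `ord_{T=0} L_p(E,T) ≤ rank E(ℚ)`
# (per-curve corollaries, PROVED from tree facts; no new named fact)

HONEST FRAMING (cell `b2b-bsdr2sha`, home `run/shared/lean/b2b/bsd-rank2-sha/`, seat LIT-1;
Literature = cited statements and their kernel-checked consequences only). This file proves, for ONE
elliptic curve `E/ℚ` (globally minimal `W`) and ONE prime `p`, the squeeze that the cell's census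
uses to certify "`Ш(E/ℚ)[p^∞]` is finite" for a curve of rank `2` (or any rank): it asserts nothing
about BSD and books no row. Theorems only (0 new `def … : Prop`, debt delta 0); every hypothesis that
is a published theorem enters BY NAME as the tree's named fact.

## The printed argument (Kato, Astérisque 295 (2004), Thm. 18.4, p. 281; used this way by
## Stein–Wuthrich, Math. Comp. 82 (2013), §10, p. 26, "b ≥ ord_{T=0} L_p(E,T) ≥ ord_{T=0} f_E(T) ≥ r")

Kato, Thm. 18.4 (k = 2, F = ℚ, α the unit root, non-exceptional clause), AS PRINTED: "Let `T` be
Gal(ℚ̄/ℚ)-stable `O_λ`-lattice of `V_{F_λ}(f)(k/2)`. Then we have `≤` in place of `=` in Conj. 18.2.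
That is, `corank_{O_λ}(Sel(T)) ≤ ord_{s=k/2}(L_{p-adic,α}(f))` if `α ≠ p^{(k−2)/2}` … In particular,
if `k = 2`, `F = ℚ`, and `f` corresponds to an elliptic curve `E` over `ℚ`, we have
`rank(E(ℚ)) ≤ ord_{s=1}(L_{p-adic,α}(f))` if `E` is not a Tate curve". No image, irreducibility,
ramification or parity hypothesis is printed on Thm. 18.4; the tree vendors it at an ODD good
ordinary prime as the named fact `kato_selmerCorank_le_order_padicLFunction W p`
(`KatoRankBound.lean`; every-prime twin `kato_selmerCorank_le_order_padicLFunction_allPrimes`, itself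
PROVED from Kato's divisibility Thm. 17.4 (1)(2) = bsd.S20 `kato_divisibility` in
`KatoRankBoundSelmerProofs.lean` / `KatoRankBoundAllPrimesProofs.lean`).

The squeeze. Kummer theory gives `corank_{ℤ_p} Sel_{p^∞}(E/ℚ) = rank E(ℚ) + corank_{ℤ_p} Ш(E/ℚ)[p^∞]`
(Greenberg, LNM 1716 (1999), §1, pp. 54–57; tree THEOREM
`WeierstrassCurve.selmerCorank_eq_mordellWeilRank_add_holds`), and a `p`-primary group with finite
`p`-torsion and `ℤ_p`-corank `0` is finite (tree theorem
`finite_primaryComponent_sha_iff_shaCorank_eq_zero`). Hence, if `ord_{T=0} L_p(E,T) ≤ rank E(ℚ)`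
— in the census: `n` independent points are EXHIBITED (`n ≤ rank E(ℚ)`) and the `T^n`-coefficient of
the certified `p`-adic `L`-series is NON-ZERO (`ord_{T=0} L_p ≤ n`) — then Kato's inequality closes
the chain `rank ≤ corank Sel_{p^∞} ≤ ord_{T=0} L_p ≤ rank`, so `corank Ш[p^∞] = 0`: `Ш(E/ℚ)[p^∞]`
is finite, and as by-products `rank E(ℚ) = corank Sel_{p^∞} = ord_{T=0} L_p(E,T) = n` EXACTLY (the
`p`-adic BSD rank prediction at this `p`, and an unconditional rank certificate). Neither the
`p`-adic height / regulator nor any hypothesis of the Skinner–Urban equality (irreducibility, the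
ramified prime `q ‖ N`, the image of `ρ_{E,p}`) enters — those are needed only for the ORDER of
`Ш[p^∞]` (Perrin-Riou–Schneider `Schneider1985_order_charGenerator` + bsd.S21
`skinner_urban_main_conjecture`), not for its finiteness. Stein–Wuthrich (loc. cit., Algorithm 11.1
step (3), p. 27) print the same exit: "If the order of vanishing `ord_{T=0} L_p(E,T)` is equal to `r`
… then we print that `Ш(E/ℚ)(p)` is finite".

## What is here (all PROVED; `W` globally minimal over `ℚ`, `f` the newform of `E`, `α = unitRoot W p`)

* `finite_sha_primary_of_selmerCorank_le_mordellWeilRank` — pure algebra: `corank Sel_{p^∞} ≤ rank`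
  ⇒ `Ш[p^∞]` finite ∧ `corank Sel_{p^∞} = rank` ∧ `corank Ш[p^∞] = 0` (any number field is not
  needed by the cell; stated over `ℚ` like its consumers).
* `finite_sha_primary_of_order_padicLFunction_le_mordellWeilRank` — from the named fact
  `kato_selmerCorank_le_order_padicLFunction W p` (hypothesis `hK`), `p ≠ 2`, `IsOrdinaryAt W p`,
  `IsNewformOf W f` and `ord_{T=0} L_p(E,T) ≤ rank E(ℚ)`: `Ш[p^∞]` finite, `corank Sel = rank`,
  `corank Ш[p^∞] = 0` and `ord_{T=0} L_p(E,T) = rank E(ℚ)`.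
* `finite_sha_primary_of_coeff_padicLFunction_ne_zero` — the CERTIFICATE shape: a non-zero
  `T^n`-coefficient of `L_p(E,T)` and `n ≤ rank E(ℚ)` give all of the above with `rank E(ℚ) = n`.
* `…_allPrimes` twins from `kato_selmerCorank_le_order_padicLFunction_allPrimes` (no parity binder;
  Kato's Thm. 18.4 is parity-free in print), and `…_of_kato_divisibility` twins taking bsd.S20
  `kato_divisibility W p` (for all cyclotomic data `κ, γ`) instead, through the tree's proved
  reduction `kato_selmerCorank_le_order_padicLFunction_of_kato_divisibility`.

## References

* K. Kato, Astérisque 295 (2004): Thm. 18.4 (p. 281), Thm. 17.4 (p. 273). [Kato2004Asterisque]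
* W. Stein, C. Wuthrich, Math. Comp. 82 (2013) 1757–1792: §10 (p. 26, Prop. 10.1), Algorithm 11.1
  (p. 27), Prop. 11.2 (p. 28). [SteinWuthrich2013]
* R. Greenberg, LNM 1716 (1999), §1, pp. 54–57 (the corank identity). [GreenbergLNM1716]
* Cell typing sheet: `run/shared/lean/b2b/bsd-rank2-sha/lit/KATO-SU-AS-PRINTED.md` §5 (F).
-/

noncomputable section

open scoped Classical MatrixGroups ModularForm

open CongruenceSubgroup Literature.NumberTheory.EllipticCurves.ModularForms

namespace Literature.NumberTheory.EllipticCurves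

/-! ### The algebraic squeeze (no `L`-function) -/

section Algebra

variable (W : WeierstrassCurve ℚ) [W.IsElliptic] (p : ℕ) [Fact p.Prime]

/-- **`corank_{ℤ_p} Sel_{p^∞}(E/ℚ) ≤ rank E(ℚ)` forces `Ш(E/ℚ)[p^∞]` finite**, with
`corank Sel_{p^∞} = rank` and `corank Ш[p^∞] = 0`: the Kummer corank identity
`corank Sel_{p^∞} = rank + corank Ш[p^∞]` (tree theorem
`WeierstrassCurve.selmerCorank_eq_mordellWeilRank_add_holds`, Greenberg LNM 1716 §1) and "corank `0`
⇔ finite" for the `p`-primary group `Ш[p^∞]` with finite `Ш[p]`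
(`finite_primaryComponent_sha_iff_shaCorank_eq_zero`). [cite: GreenbergLNM1716, §1 (pp. 54–57)] -/
theorem finite_sha_primary_of_selmerCorank_le_mordellWeilRank
    (h : W.selmerCorank p ≤ W.mordellWeilRank) :
    Finite (AddCommGroup.primaryComponent W.sha p) ∧
      W.selmerCorank p = W.mordellWeilRank ∧ W.shaCorank p = 0 := by
  have hadd : W.selmerCorank p = W.mordellWeilRank + W.shaCorank p :=
    W.selmerCorank_eq_mordellWeilRank_add_holds p
  have hsha : W.shaCorank p = 0 := by omega
  exact ⟨(finite_primaryComponent_sha_iff_shaCorank_eq_zero W p).mpr hsha, by omega, hsha⟩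

/-- The same squeeze in `ℕ∞`, the shape in which Kato's bound is stated (`PowerSeries.order`):
if `corank Sel_{p^∞}(E/ℚ) ≤ b` for some `b : ℕ∞` with `b ≤ rank E(ℚ)`, then `Ш(E/ℚ)[p^∞]` is finite,
`corank Sel_{p^∞} = rank`, `corank Ш[p^∞] = 0` and `b = rank E(ℚ)`. [cite: GreenbergLNM1716, §1 (pp. 54–57)] -/
theorem finite_sha_primary_of_selmerCorank_le_of_le_mordellWeilRank {b : ℕ∞}
    (hSel : (W.selmerCorank p : ℕ∞) ≤ b) (hb : b ≤ (W.mordellWeilRank : ℕ∞)) :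
    Finite (AddCommGroup.primaryComponent W.sha p) ∧
      W.selmerCorank p = W.mordellWeilRank ∧ W.shaCorank p = 0 ∧ b = W.mordellWeilRank := by
  have h1 : (W.selmerCorank p : ℕ∞) ≤ (W.mordellWeilRank : ℕ∞) := hSel.trans hb
  have h2 : W.selmerCorank p ≤ W.mordellWeilRank := by exact_mod_cast h1
  obtain ⟨hfin, heq, hsha⟩ := finite_sha_primary_of_selmerCorank_le_mordellWeilRank W p h2
  refine ⟨hfin, heq, hsha, le_antisymm hb ?_⟩
  calc (W.mordellWeilRank : ℕ∞) = (W.selmerCorank p : ℕ∞) := by exact_mod_cast heq.symm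
    _ ≤ b := hSel

end Algebra

/-! ### From Kato's Thm 18.4 (named fact `kato_selmerCorank_le_order_padicLFunction`) -/

section Kato

variable (W : WeierstrassCurve ℚ) [W.IsElliptic] [W.IsGloballyMinimal] (p : ℕ) [Fact p.Prime]
  {N : ℕ} [NeZero N] {f : CuspForm (Gamma0 N) 2}

/-- **Kato Thm 18.4 ⇒ finiteness of `Ш(E/ℚ)[p^∞]` when `ord_{T=0} L_p(E,T) ≤ rank E(ℚ)`** (odd good
ordinary `p`). Given the named fact `kato_selmerCorank_le_order_padicLFunction W p` (Kato,
Astérisque 295, Thm. 18.4, p. 281: `corank_{ℤ_p} Sel_{p^∞}(E/ℚ) ≤ ord_{T=0} L_p(E,T)`), `p ≠ 2`,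
`E` good ordinary at `p`, `f` its newform, and `ord_{T=0} L_p(E,T) ≤ rank E(ℚ)`
(`L_p(E,T) = padicLFunction f α`, `α = unitRoot W p`): `Ш(E/ℚ)[p^∞]` is finite,
`corank Sel_{p^∞}(E/ℚ) = rank E(ℚ)`, `corank Ш[p^∞] = 0`, and `ord_{T=0} L_p(E,T) = rank E(ℚ)`.
This is the chain `r ≤ corank Sel ≤ ord L_p ≤ r` of Stein–Wuthrich 2013, §10 (p. 26) read with Kato's
Thm. 18.4 in place of "Thm. 6.1 + Thm. 7.3/7.4"; NO hypothesis on `ρ̄_{E,p}`, on a ramified prime, or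
on the `p`-adic height enters. [cite: Kato2004Asterisque, Thm. 18.4 (p. 281)]
[cite: SteinWuthrich2013, §10 (p. 26) and Algorithm 11.1 (3) (p. 27)] -/
theorem finite_sha_primary_of_order_padicLFunction_le_mordellWeilRank
    (hK : kato_selmerCorank_le_order_padicLFunction W p (f := f))
    (hp : p ≠ 2) (hord : IsOrdinaryAt W p) (hf : IsNewformOf W f)
    (hle : (padicLFunction f (unitRoot W p : ℚ_[p])).order ≤ (W.mordellWeilRank : ℕ∞)) :
    Finite (AddCommGroup.primaryComponent W.sha p) ∧
      W.selmerCorank p = W.mordellWeilRank ∧ W.shaCorank p = 0 ∧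
      (padicLFunction f (unitRoot W p : ℚ_[p])).order = W.mordellWeilRank :=
  finite_sha_primary_of_selmerCorank_le_of_le_mordellWeilRank W p (hK hp hord hf) hle

/-- **The census certificate shape.** Given the named fact `kato_selmerCorank_le_order_padicLFunction
W p` (Kato Thm. 18.4), `p ≠ 2`, `E` good ordinary at `p`, `f` its newform, a NON-ZERO
`T^n`-coefficient of `L_p(E,T) = padicLFunction f α` (the engine's exact certificate: a `p`-adic
ball around the computed coefficient excluding `0`) and `n ≤ rank E(ℚ)` (`n` independent rational
points exhibited): `Ш(E/ℚ)[p^∞]` is finite, `rank E(ℚ) = n`, `corank Sel_{p^∞}(E/ℚ) = n`,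
`corank Ш[p^∞] = 0` and `ord_{T=0} L_p(E,T) = n`. (For a rank-2 row: `n = 2`; the vanishing of the
`T^0, T^1` coefficients is then a CONSEQUENCE, `ord = 2`, not an input.)
[cite: Kato2004Asterisque, Thm. 18.4 (p. 281)] [cite: SteinWuthrich2013, Algorithm 11.1 (3) (p. 27)] -/
theorem finite_sha_primary_of_coeff_padicLFunction_ne_zero
    (hK : kato_selmerCorank_le_order_padicLFunction W p (f := f))
    (hp : p ≠ 2) (hord : IsOrdinaryAt W p) (hf : IsNewformOf W f) {n : ℕ}
    (hcoeff : PowerSeries.coeff n (padicLFunction f (unitRoot W p : ℚ_[p])) ≠ 0)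
    (hn : n ≤ W.mordellWeilRank) :
    Finite (AddCommGroup.primaryComponent W.sha p) ∧
      W.mordellWeilRank = n ∧ W.selmerCorank p = n ∧ W.shaCorank p = 0 ∧
      (padicLFunction f (unitRoot W p : ℚ_[p])).order = n := by
  have hord_le : (padicLFunction f (unitRoot W p : ℚ_[p])).order ≤ (n : ℕ∞) :=
    PowerSeries.order_le n hcoeff
  have hn' : (n : ℕ∞) ≤ (W.mordellWeilRank : ℕ∞) := by exact_mod_cast hn
  obtain ⟨hfin, hsel, hsha, hordr⟩ :=
    finite_sha_primary_of_order_padicLFunction_le_mordellWeilRank W p hK hp hord hf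
      (hord_le.trans hn')
  have hrank : W.mordellWeilRank = n := by
    refine le_antisymm ?_ hn
    have : (W.mordellWeilRank : ℕ∞) ≤ (n : ℕ∞) := hordr.symm.le.trans hord_le
    exact_mod_cast this
  refine ⟨hfin, hrank, hsel.trans hrank, hsha, ?_⟩
  rw [hordr, hrank]

/-! ### Parity-free twins (Kato's Thm 18.4 carries no `p ≠ 2` in print) -/

omit [W.IsElliptic] in
/-- Twin of `finite_sha_primary_of_order_padicLFunction_le_mordellWeilRank` from the every-prime form
`kato_selmerCorank_le_order_padicLFunction_allPrimes W p` of Kato's Thm. 18.4 (no parity binder;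
`p = 2` allowed, as printed). [cite: Kato2004Asterisque, Thm. 18.4 (p. 281)] -/
theorem finite_sha_primary_of_order_padicLFunction_le_mordellWeilRank_allPrimes [W.IsElliptic]
    (hK : kato_selmerCorank_le_order_padicLFunction_allPrimes W p (f := f))
    (hord : IsOrdinaryAt W p) (hf : IsNewformOf W f)
    (hle : (padicLFunction f (unitRoot W p : ℚ_[p])).order ≤ (W.mordellWeilRank : ℕ∞)) :
    Finite (AddCommGroup.primaryComponent W.sha p) ∧
      W.selmerCorank p = W.mordellWeilRank ∧ W.shaCorank p = 0 ∧
      (padicLFunction f (unitRoot W p : ℚ_[p])).order = W.mordellWeilRank :=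
  finite_sha_primary_of_selmerCorank_le_of_le_mordellWeilRank W p (hK hord hf) hle

omit [W.IsElliptic] in
/-- Twin of `finite_sha_primary_of_coeff_padicLFunction_ne_zero` from the every-prime form of Kato's
Thm. 18.4 (`p = 2` allowed). [cite: Kato2004Asterisque, Thm. 18.4 (p. 281)] -/
theorem finite_sha_primary_of_coeff_padicLFunction_ne_zero_allPrimes [W.IsElliptic]
    (hK : kato_selmerCorank_le_order_padicLFunction_allPrimes W p (f := f))
    (hord : IsOrdinaryAt W p) (hf : IsNewformOf W f) {n : ℕ}
    (hcoeff : PowerSeries.coeff n (padicLFunction f (unitRoot W p : ℚ_[p])) ≠ 0)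
    (hn : n ≤ W.mordellWeilRank) :
    Finite (AddCommGroup.primaryComponent W.sha p) ∧
      W.mordellWeilRank = n ∧ W.selmerCorank p = n ∧ W.shaCorank p = 0 ∧
      (padicLFunction f (unitRoot W p : ℚ_[p])).order = n := by
  have hord_le : (padicLFunction f (unitRoot W p : ℚ_[p])).order ≤ (n : ℕ∞) :=
    PowerSeries.order_le n hcoeff
  have hn' : (n : ℕ∞) ≤ (W.mordellWeilRank : ℕ∞) := by exact_mod_cast hn
  obtain ⟨hfin, hsel, hsha, hordr⟩ :=
    finite_sha_primary_of_order_padicLFunction_le_mordellWeilRank_allPrimes W p hK hord hf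
      (hord_le.trans hn')
  have hrank : W.mordellWeilRank = n := by
    refine le_antisymm ?_ hn
    have : (W.mordellWeilRank : ℕ∞) ≤ (n : ℕ∞) := hordr.symm.le.trans hord_le
    exact_mod_cast this
  refine ⟨hfin, hrank, hsel.trans hrank, hsha, ?_⟩
  rw [hordr, hrank]

/-! ### From bsd.S20 `kato_divisibility` (Kato Thm 17.4) instead of the Thm 18.4 fact -/

/-- Twin of `finite_sha_primary_of_coeff_padicLFunction_ne_zero` taking Kato's divisibility
bsd.S20 `kato_divisibility W p` (Thm. 17.4: `X(E/ℚ_∞)` torsion and `char_Λ X ∣ p^m L_p(E,T)`) for all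
cyclotomic data `κ, γ` as the named-fact input, through the tree's PROVED reduction
`kato_selmerCorank_le_order_padicLFunction_of_kato_divisibility` (Mazur control in corank form +
structure theorem). Same conclusions: `Ш(E/ℚ)[p^∞]` finite, `rank E(ℚ) = corank Sel_{p^∞} =
ord_{T=0} L_p(E,T) = n`, `corank Ш[p^∞] = 0`.
[cite: Kato2004Asterisque, Thm. 17.4 (p. 273), Thm. 18.4 (p. 281)] -/
theorem finite_sha_primary_of_coeff_padicLFunction_ne_zero_of_kato_divisibility
    (hkato : ∀ (κ : ZpExtension ℚ p) (γ : Field.absoluteGaloisGroup ℚ),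
      kato_divisibility W p (κ := κ) (γ := γ) (f := f))
    (hp : p ≠ 2) (hord : IsOrdinaryAt W p) (hf : IsNewformOf W f) {n : ℕ}
    (hcoeff : PowerSeries.coeff n (padicLFunction f (unitRoot W p : ℚ_[p])) ≠ 0)
    (hn : n ≤ W.mordellWeilRank) :
    Finite (AddCommGroup.primaryComponent W.sha p) ∧
      W.mordellWeilRank = n ∧ W.selmerCorank p = n ∧ W.shaCorank p = 0 ∧
      (padicLFunction f (unitRoot W p : ℚ_[p])).order = n :=
  finite_sha_primary_of_coeff_padicLFunction_ne_zero W p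
    (kato_selmerCorank_le_order_padicLFunction_of_kato_divisibility W p hkato) hp hord hf hcoeff hn

end Kato

end Literature.NumberTheory.EllipticCurves

end
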